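import Mathlib
import Summits.CriticalPhenomena.CardyFormulaZ2.Theorems.CardySelfRefinementDefs
import Literature.Probability.Percolation.SelfRefinementMeasure
import HarnessLib

/-!
# Stub `stub_localEngine` of line `far-field-is-a-quarter-turn` (crux `TrivialSectorRate`,
stmt-CriticalPhenomena-10266): the QUARTER TURN — `M_k(ρ,c)` is invariant under the rotation by
`90°` about every coarse vertex `k•u` of `kℤ²`

The engine of the line compares the orbit-grouped coin responses `Tρ(u)`, `Tc(u)` of the block of
a coarse vertex `u`; its mechanism is the `C₄(u)`-symmetry of the self-refinement model
`M_k(ρ,c) = (prodBernoulli (prm k ρ c)).map (cfg k)` about the fine vertex `ctr k u = k•u`.  The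
tree (`Literature/Probability/Percolation/SelfRefinementMeasure.lean`) has the transfer principle
`relabel_refinementConfig` / `selfRefinementMeasure_map_relabel` and its three generating
instances (translations by `kℤ²`, the transposition, the reflection `x₀ ↦ -x₀`); this file
composes them into the quarter turn and states everything for the route's abbreviations `cfg`,
`prm`, `M`, `coinLaw` (which are the tree's `refinementConfig`, `refinementParam`,
`selfRefinementMeasure` term for term).

* **Intertwined pairs.**  A bijection `g` of the sites and a bijection `σ` of the coins are
  *intertwined* when `g '' (cfg k S) = cfg k (σ ⁻¹' S)` for every coin set `S` (the configuration
  of the pulled-back coins is the relabelled configuration; `σ i` is the coin read, after the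
  motion, at the place of `i`, i.e. the coin of the PRE-image edge / bundle).  If moreover `σ`
  preserves the biases `prm k ρ c`, then the coin law is invariant under `S ↦ σ ⁻¹' S`
  (`prodBernoulli_prm_map_preimage`, `coinLaw_real_preimage_pullback` — no measurability needed,
  the pull-back is a measurable equivalence) and `M_k(ρ,c)` is invariant under `ω ↦ g '' ω`
  (`M_map_relabel_of_intertwine`, `M_real_preimage_relabel_of_intertwine`).  Intertwined pairs
  compose and invert (`intertwine_trans`, `intertwine_symm`); the generators are
  `intertwine_shift` (`k ≠ 0`), `intertwine_transpose`, `intertwine_reflect` (`k ≠ 0`).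
* **The quarter turn about `k•u`** (`exists_quarterTurn`, `k ≠ 0`): the site map
  `g x = (c₀ + c₁ − x₁, x₀ − c₀ + c₁)`, `c = ctr k u` (rotation by `+90°` about `c`), is
  intertwined with the coin permutation `σ` acting on own coins by
  `σ (v, d, 0) = ((v₁ − c₁ + c₀, c₀ + c₁ − v₀ − [d = 0]), 1 − d, 0)` and on the shared / selector
  coins of the bundle `(t, d)` by `σ (t, d, j) = ((t₁ − u₁ + u₀, u₀ + u₁ − t₀ − [d = 0]), 1 − d, j)`,
  and `σ` preserves all biases.  Both maps are pinned down by these formulas, so the consequences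
  are stated for ANY `g`, `σ` satisfying them: **`M_k(ρ,c)` is invariant under the quarter turn and
  its inverse** (`M_map_relabel_quarterTurn[_symm]`, `M_real_preimage_relabel_quarterTurn[_symm]`).
* **Influences are equivariant** (ANY event `B`, no measurability): the signed influence
  `coinLaw {S | insert i S ∈ ·} − coinLaw {S | S \ {i} ∈ ·}` of the coin `i` on the coin event of
  the rotated event `{ω | g '' ω ∈ B}` is that of `σ⁻¹ i` on the coin event of `B`
  (`infl_pullback_eq` for intertwined pairs, `infl_quarterTurn` for the quarter turn).

The `C₄(u)`-invariance of the orbit sums over `bundlesAt u` and the interior edges of `cellsAt u`,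
and the conditional (far-field) forms, are in the companion files `…RotationCoins.lean`,
`…RotationCond.lean`.
-/

noncomputable section

namespace Summit.CriticalPhenomena.CardyFormulaZ2.Theorems.CardySelfRefinement.FarField

open Set MeasureTheory
open Literature.Probability.LatticeModels Literature.Probability.Percolation
open Literature.Probability.Percolation.QuadCrossing
open Summit.CriticalPhenomena.CardyFormulaZ2.Theses.CardySelfRefinement

/-! ### Intertwined pairs: transfer of the coin law and of `M_k` -/

/-- The pull-back of the coins along a bias-preserving coin permutation `σ` preserves the coin
product measure: `(prodBernoulli (prm k ρ c)).map (σ ⁻¹' ·) = prodBernoulli (prm k ρ c)`. -/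
theorem prodBernoulli_prm_map_preimage (k : ℕ) (ρ c : ℝ) (σ : Coin ≃ Coin)
    (hprm : ∀ i, prm k ρ c (σ i) = prm k ρ c i) :
    (prodBernoulli (prm k ρ c)).map (fun S : Set Coin => σ ⁻¹' S) = prodBernoulli (prm k ρ c) := by
  rw [prodBernoulli_map_preimage _ σ.injective]
  exact congrArg prodBernoulli (funext hprm)

/-- The same for the coin law `coinLaw k q` at the parameter point `q = (ρ, c)`. -/
theorem coinLaw_map_preimage (k : ℕ) (q : ℝ × ℝ) (σ : Coin ≃ Coin)
    (hprm : ∀ i, prm k q.1 q.2 (σ i) = prm k q.1 q.2 i) :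
    (coinLaw k q).map (fun S : Set Coin => σ ⁻¹' S) = coinLaw k q :=
  prodBernoulli_prm_map_preimage k q.1 q.2 σ hprm

/-- The pull-back `S ↦ σ ⁻¹' S` of coin sets is the measurable equivalence
`SiteConfig.relabel σ⁻¹` of the coin space. -/
theorem coe_relabel_symm_eq_preimage (σ : Coin ≃ Coin) :
    ⇑(SiteConfig.relabel σ.symm) = fun S : Set Coin => σ ⁻¹' S :=
  funext fun S => Equiv.image_symm_eq_preimage σ S

/-- The pull-back of the coins is measurable. -/
theorem measurable_preimage_coin (σ : Coin ≃ Coin) : Measurable fun S : Set Coin => σ ⁻¹' S := by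
  rw [← coe_relabel_symm_eq_preimage]
  exact MeasurableEquiv.measurable _

/-- **The coin law is invariant under bias-preserving coin permutations, event by event**:
`coinLaw {S | σ ⁻¹' S ∈ X} = coinLaw X` for EVERY `X` (no measurability: the pull-back is a
measurable equivalence). -/
theorem coinLaw_real_preimage_pullback (k : ℕ) (q : ℝ × ℝ) (σ : Coin ≃ Coin)
    (hprm : ∀ i, prm k q.1 q.2 (σ i) = prm k q.1 q.2 i) (X : Set (Set Coin)) :
    (coinLaw k q).real ((fun S : Set Coin => σ ⁻¹' S) ⁻¹' X) = (coinLaw k q).real X := by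
  have h := MeasurableEquiv.map_apply (μ := coinLaw k q) (SiteConfig.relabel σ.symm) X
  rw [coe_relabel_symm_eq_preimage, coinLaw_map_preimage k q σ hprm] at h
  rw [measureReal_def, measureReal_def, ← h]

/-- **Invariance principle for `M_k(ρ,c)`**: if the site bijection `g` and the coin bijection `σ`
are intertwined (`g '' (cfg k S) = cfg k (σ ⁻¹' S)`) and `σ` preserves the biases, then
`M_k(ρ,c)` is invariant under the relabelling `ω ↦ g '' ω`. -/
theorem M_map_relabel_of_intertwine (k : ℕ) (ρ c : ℝ) (g : Site 2 ≃ Site 2) (σ : Coin ≃ Coin)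
    (hcfg : ∀ S, BondConfig.relabel (sym2Equiv g) (cfg k S) = cfg k (σ ⁻¹' S))
    (hprm : ∀ i, prm k ρ c (σ i) = prm k ρ c i) :
    (M k ρ c).map (BondConfig.relabel (sym2Equiv g)) = M k ρ c := by
  have hmc : Measurable (cfg k) := measurable_refinementConfig k
  show ((prodBernoulli (prm k ρ c)).map (cfg k)).map _ = (prodBernoulli (prm k ρ c)).map (cfg k)
  rw [Measure.map_map (MeasurableEquiv.measurable _) hmc,
    show (BondConfig.relabel (sym2Equiv g)) ∘ cfg k = cfg k ∘ fun S : Set Coin => σ ⁻¹' S from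
      funext hcfg,
    ← Measure.map_map hmc (measurable_preimage_coin σ), prodBernoulli_prm_map_preimage k ρ c σ hprm]

/-- Applied form of the invariance principle: `M_k {ω | g '' ω ∈ A} = M_k(A)` for every `A`. -/
theorem M_real_preimage_relabel_of_intertwine (k : ℕ) (ρ c : ℝ) (g : Site 2 ≃ Site 2)
    (σ : Coin ≃ Coin) (hcfg : ∀ S, BondConfig.relabel (sym2Equiv g) (cfg k S) = cfg k (σ ⁻¹' S))
    (hprm : ∀ i, prm k ρ c (σ i) = prm k ρ c i) (A : Set (BondConfig (Site 2))) :
    (M k ρ c).real (BondConfig.relabel (sym2Equiv g) ⁻¹' A) = (M k ρ c).real A := by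
  rw [measureReal_def, measureReal_def, ← MeasurableEquiv.map_apply,
    M_map_relabel_of_intertwine k ρ c g σ hcfg hprm]

/-! ### Intertwined pairs compose and invert -/

-- adapted from Summits/PercolationContinuityZ3/Theorems/PercThresholdOneStationaryWeavingVanishingProfile.lean
/-- Relabelling along a composite bijection is the composite of the relabellings. -/
theorem relabel_sym2Equiv_trans (g₁ g₂ : Site 2 ≃ Site 2) (ω : BondConfig (Site 2)) :
    BondConfig.relabel (sym2Equiv (g₁.trans g₂)) ω =
      BondConfig.relabel (sym2Equiv g₂) (BondConfig.relabel (sym2Equiv g₁) ω) := by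
  ext z
  simp only [BondConfig.mem_relabel_iff, sym2Equiv_symm, sym2Equiv_apply, Sym2.map_map]
  rfl

/-- Intertwined pairs compose: `(g₁ then g₂, σ₂ then σ₁)`. -/
theorem intertwine_trans {k : ℕ} {g₁ g₂ : Site 2 ≃ Site 2} {σ₁ σ₂ : Coin ≃ Coin}
    (h₁ : ∀ S, BondConfig.relabel (sym2Equiv g₁) (cfg k S) = cfg k (σ₁ ⁻¹' S))
    (h₂ : ∀ S, BondConfig.relabel (sym2Equiv g₂) (cfg k S) = cfg k (σ₂ ⁻¹' S)) (S : Set Coin) :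
    BondConfig.relabel (sym2Equiv (g₁.trans g₂)) (cfg k S) = cfg k ((σ₂.trans σ₁) ⁻¹' S) := by
  rw [relabel_sym2Equiv_trans, h₁, h₂, Equiv.coe_trans, Set.preimage_comp]

/-- Intertwined pairs invert: `(g⁻¹, σ⁻¹)`. -/
theorem intertwine_symm {k : ℕ} {g : Site 2 ≃ Site 2} {σ : Coin ≃ Coin}
    (h : ∀ S, BondConfig.relabel (sym2Equiv g) (cfg k S) = cfg k (σ ⁻¹' S)) (S : Set Coin) :
    BondConfig.relabel (sym2Equiv g.symm) (cfg k S) = cfg k (σ.symm ⁻¹' S) := by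
  have h' := h (σ.symm ⁻¹' S)
  rw [Equiv.preimage_symm_preimage] at h'
  rw [← h']
  exact relabel_symm_relabel g _

/-! ### The generators: `kℤ²`-translations, the transposition, the reflection `x₀ ↦ -x₀` -/

/-- A coin reindexing `coinReindex πe πt` whose edge part preserves axiality preserves the biases. -/
theorem prm_coinReindex (k : ℕ) (ρ c : ℝ) {πe : Site 2 × Fin 2 ≃ Site 2 × Fin 2}
    (πt : Site 2 × Fin 2 ≃ Site 2 × Fin 2) (h2 : ∀ e, ax k (πe e) ↔ ax k e) (i : Coin) :
    prm k ρ c (coinReindex πe πt i) = prm k ρ c i :=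
  refinementParam_coinReindex k ρ c πt h2 i

/-- **Translations by `kℤ²`** (`k ≠ 0`): the shift `x ↦ x + k a` is intertwined with the coin
reindexing by `shiftEdge k a` (own coins: `v ↦ v − k a`) and `shiftTuple a` (bundles: `t ↦ t − a`). -/
theorem intertwine_shift {k : ℕ} (hk : k ≠ 0) (a : Site 2) (S : Set Coin) :
    BondConfig.relabel (sym2Equiv (Site.shift ((k : ℤ) • a))) (cfg k S) =
      cfg k (coinReindex (shiftEdge k a) (shiftTuple a) ⁻¹' S) := by
  refine relabel_refinementConfig k (zdShiftIso ((k : ℤ) • a)) (πe := shiftEdge k a)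
    (πt := shiftTuple a) (fun e => ?_) (isAxialEdge_shiftEdge k a) (fun e _ => ?_) S
  · obtain ⟨v, d⟩ := e
    rw [shiftEdge_apply]
    exact sym2Equiv_symm_cornerEdge_shift _ v d
  · rw [shiftTuple_apply, tupleBase_shiftEdge hk]
    obtain ⟨v, d⟩ := e
    simp

/-- **The transposition** `(x₀, x₁) ↦ (x₁, x₀)` is intertwined with `transposeLabel` on both layers. -/
theorem intertwine_transpose (k : ℕ) (S : Set Coin) :
    BondConfig.relabel (sym2Equiv transposeEquiv) (cfg k S) =
      cfg k (coinReindex transposeLabel transposeLabel ⁻¹' S) := by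
  refine relabel_refinementConfig k transposeIso (πe := transposeLabel) (πt := transposeLabel)
    (fun e => ?_) (isAxialEdge_transposeLabel k) (fun e _ => ?_) S
  · obtain ⟨v, d⟩ := e
    rw [transposeIso_toEquiv, transposeLabel_apply]
    exact sym2Equiv_symm_cornerEdge_transpose v d
  · rw [tupleBase_transposeLabel]
    obtain ⟨v, d⟩ := e
    simp

/-- **The reflection** `(x₀, x₁) ↦ (-x₀, x₁)` (`k ≠ 0`) is intertwined with `reflectLabel` on both
layers. -/
theorem intertwine_reflect {k : ℕ} (hk : k ≠ 0) (S : Set Coin) :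
    BondConfig.relabel (sym2Equiv (reflectIso (0 : Fin 2)).toEquiv) (cfg k S) =
      cfg k (coinReindex reflectLabel reflectLabel ⁻¹' S) :=
  relabel_refinementConfig k (reflectIso 0) (πe := reflectLabel) (πt := reflectLabel)
    (fun e => by obtain ⟨v, d⟩ := e; exact sym2Equiv_symm_cornerEdge_reflect v d)
    (isAxialEdge_reflectLabel k) (fun _ hax => reflectLabel_tupleBase hk hax) S

/-! ### The quarter turn about the coarse vertex `k•u` -/

/-- Coordinates of the block centre: `ctr k u i = k * u i`. -/
theorem ctr_apply (k : ℕ) (u : Site 2) (i : Fin 2) : ctr k u i = (k : ℤ) * u i := rfl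

/-- **The quarter turn about `k•u` as an intertwined pair** (`k ≠ 0`).  There are a site bijection
`g` — the rotation by `+90°` about `c = ctr k u`, `g x = (c₀ + c₁ − x₁, x₀ − c₀ + c₁)` — and a coin
bijection `σ` — own coins: `σ (v,d,0)` is the own coin of the pre-image edge
`g⁻¹ {v, v + e_d}`, namely `((v₁ − c₁ + c₀, c₀ + c₁ − v₀ − [d = 0]), 1 − d, 0)`; shared coins and
selectors: `σ (t,d,j)` is the same coin of the pre-image bundle,
`((t₁ − u₁ + u₀, u₀ + u₁ − t₀ − [d = 0]), 1 − d, j)` — such that `g '' (cfg k S) = cfg k (σ ⁻¹' S)`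
for all coin sets `S` and `σ` preserves every bias `prm k ρ c`.  (Composite of the tree's
generators: shift by `−k u`, transpose, reflect `x₀ ↦ −x₀`, shift by `k u`.) -/
theorem exists_quarterTurn {k : ℕ} (hk : k ≠ 0) (u : Site 2) :
    ∃ (g : Site 2 ≃ Site 2) (σ : Coin ≃ Coin),
      (∀ x, g x = ![ctr k u 0 + ctr k u 1 - x 1, x 0 - ctr k u 0 + ctr k u 1]) ∧
      (∀ (v : Site 2) (d : Fin 2), σ (v, d, 0) =
        (![v 1 - ctr k u 1 + ctr k u 0, ctr k u 0 + ctr k u 1 - v 0 - (if d = 0 then 1 else 0)],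
          Equiv.swap 0 1 d, 0)) ∧
      (∀ (t : Site 2) (d : Fin 2) (j : Fin 3), j ≠ 0 → σ (t, d, j) =
        (![t 1 - u 1 + u 0, u 0 + u 1 - t 0 - (if d = 0 then 1 else 0)], Equiv.swap 0 1 d, j)) ∧
      (∀ S, BondConfig.relabel (sym2Equiv g) (cfg k S) = cfg k (σ ⁻¹' S)) ∧
      (∀ (ρ c : ℝ) (i : Coin), prm k ρ c (σ i) = prm k ρ c i) := by
  refine ⟨(((Site.shift ((k : ℤ) • -u)).trans transposeEquiv).trans
      (reflectIso (0 : Fin 2)).toEquiv).trans (Site.shift ((k : ℤ) • u)),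
    (coinReindex (shiftEdge k u) (shiftTuple u)).trans ((coinReindex reflectLabel reflectLabel).trans
      ((coinReindex transposeLabel transposeLabel).trans
        (coinReindex (shiftEdge k (-u)) (shiftTuple (-u))))),
    fun x => ?_, fun v d => ?_, fun t d j hj => ?_, fun S => ?_, fun ρ c i => ?_⟩
  · have h1 : ∀ i, (Equiv.symm (1 : Equiv.Perm (Fin 2))) i = i := fun _ => rfl
    funext i
    fin_cases i <;> simp [Site.signedPerm_apply, ctr_apply, h1] <;> ring
  · simp only [Equiv.trans_apply, coinReindex_apply_zero, shiftEdge_apply, reflectLabel_apply,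
      transposeLabel_apply, Prod.mk.injEq, and_true]
    funext i
    fin_cases i <;> fin_cases d <;> simp [Site.signedPerm_apply, ctr_apply] <;> ring
  · fin_cases j
    · exact absurd rfl hj
    · simp only [Equiv.trans_apply, Fin.mk_one, coinReindex_apply_one, shiftTuple_apply,
        reflectLabel_apply, transposeLabel_apply, Prod.mk.injEq, and_true]
      funext i
      fin_cases i <;> fin_cases d <;> simp [Site.signedPerm_apply] <;> ring
    · simp only [Equiv.trans_apply, Fin.reduceFinMk, coinReindex_apply_two, shiftTuple_apply,
        reflectLabel_apply, transposeLabel_apply, Prod.mk.injEq, and_true]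
      funext i
      fin_cases i <;> fin_cases d <;> simp [Site.signedPerm_apply] <;> ring
  · exact intertwine_trans (intertwine_trans (intertwine_trans (intertwine_shift hk (-u))
      (intertwine_transpose k)) (intertwine_reflect hk)) (intertwine_shift hk u) S
  · rw [Equiv.trans_apply, Equiv.trans_apply, Equiv.trans_apply,
      prm_coinReindex k ρ c (shiftTuple (-u)) (isAxialEdge_shiftEdge k (-u)),
      prm_coinReindex k ρ c transposeLabel (isAxialEdge_transposeLabel k),
      prm_coinReindex k ρ c reflectLabel (isAxialEdge_reflectLabel k),
      prm_coinReindex k ρ c (shiftTuple u) (isAxialEdge_shiftEdge k u)]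

/-- The quarter turn is pinned down by its formula. -/
theorem quarterTurn_unique {k : ℕ} {u : Site 2} {g g' : Site 2 ≃ Site 2}
    (hg : ∀ x, g x = ![ctr k u 0 + ctr k u 1 - x 1, x 0 - ctr k u 0 + ctr k u 1])
    (hg' : ∀ x, g' x = ![ctr k u 0 + ctr k u 1 - x 1, x 0 - ctr k u 0 + ctr k u 1]) : g = g' :=
  Equiv.ext fun x => (hg x).trans (hg' x).symm

/-- The coin permutation of the quarter turn is pinned down by its formulas. -/
theorem quarterTurn_coin_unique {k : ℕ} {u : Site 2} {σ σ' : Coin ≃ Coin}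
    (h0 : ∀ (v : Site 2) (d : Fin 2), σ (v, d, 0) =
      (![v 1 - ctr k u 1 + ctr k u 0, ctr k u 0 + ctr k u 1 - v 0 - (if d = 0 then 1 else 0)],
        Equiv.swap 0 1 d, 0))
    (h : ∀ (t : Site 2) (d : Fin 2) (j : Fin 3), j ≠ 0 → σ (t, d, j) =
      (![t 1 - u 1 + u 0, u 0 + u 1 - t 0 - (if d = 0 then 1 else 0)], Equiv.swap 0 1 d, j))
    (h0' : ∀ (v : Site 2) (d : Fin 2), σ' (v, d, 0) =
      (![v 1 - ctr k u 1 + ctr k u 0, ctr k u 0 + ctr k u 1 - v 0 - (if d = 0 then 1 else 0)],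
        Equiv.swap 0 1 d, 0))
    (h' : ∀ (t : Site 2) (d : Fin 2) (j : Fin 3), j ≠ 0 → σ' (t, d, j) =
      (![t 1 - u 1 + u 0, u 0 + u 1 - t 0 - (if d = 0 then 1 else 0)], Equiv.swap 0 1 d, j)) :
    σ = σ' := by
  refine Equiv.ext fun i => ?_
  obtain ⟨v, d, j⟩ := i
  by_cases hj : j = 0
  · subst hj
    rw [h0, h0']
  · rw [h v d j hj, h' v d j hj]

/-- **`M_k(ρ,c)` is invariant under the quarter turn about every coarse vertex `k•u`** (`k ≠ 0`):
for the rotation `g x = (c₀ + c₁ − x₁, x₀ − c₀ + c₁)` by `+90°` about `c = ctr k u`,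
`(M k ρ c).map (g '' ·) = M k ρ c`. -/
theorem M_map_relabel_quarterTurn {k : ℕ} (hk : k ≠ 0) (ρ c : ℝ) (u : Site 2) (g : Site 2 ≃ Site 2)
    (hg : ∀ x, g x = ![ctr k u 0 + ctr k u 1 - x 1, x 0 - ctr k u 0 + ctr k u 1]) :
    (M k ρ c).map (BondConfig.relabel (sym2Equiv g)) = M k ρ c := by
  obtain ⟨g', σ, hg', -, -, hcfg, hprm⟩ := exists_quarterTurn hk u
  obtain rfl : g = g' := quarterTurn_unique hg hg'
  exact M_map_relabel_of_intertwine k ρ c g σ hcfg (hprm ρ c)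

/-- Applied form: `M_k(ρ,c) {ω | g '' ω ∈ A} = M_k(ρ,c)(A)` for the quarter turn `g` about `k•u`
and every event `A`. -/
theorem M_real_preimage_relabel_quarterTurn {k : ℕ} (hk : k ≠ 0) (ρ c : ℝ) (u : Site 2)
    (g : Site 2 ≃ Site 2) (hg : ∀ x, g x = ![ctr k u 0 + ctr k u 1 - x 1, x 0 - ctr k u 0 + ctr k u 1])
    (A : Set (BondConfig (Site 2))) :
    (M k ρ c).real (BondConfig.relabel (sym2Equiv g) ⁻¹' A) = (M k ρ c).real A := by
  rw [measureReal_def, measureReal_def, ← MeasurableEquiv.map_apply,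
    M_map_relabel_quarterTurn hk ρ c u g hg]

/-- `M_k(ρ,c)` is invariant under the INVERSE quarter turn (rotation by `−90°` about `k•u`). -/
theorem M_map_relabel_quarterTurn_symm {k : ℕ} (hk : k ≠ 0) (ρ c : ℝ) (u : Site 2)
    (g : Site 2 ≃ Site 2) (hg : ∀ x, g x = ![ctr k u 0 + ctr k u 1 - x 1, x 0 - ctr k u 0 + ctr k u 1]) :
    (M k ρ c).map (BondConfig.relabel (sym2Equiv g.symm)) = M k ρ c := by
  obtain ⟨g', σ, hg', -, -, hcfg, hprm⟩ := exists_quarterTurn hk u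
  obtain rfl : g = g' := quarterTurn_unique hg hg'
  exact M_map_relabel_of_intertwine k ρ c g.symm σ.symm (intertwine_symm hcfg)
    fun i => by rw [← hprm ρ c (σ.symm i), Equiv.apply_symm_apply]

/-- Applied form for the inverse quarter turn: `M_k(ρ,c) {ω | g⁻¹ '' ω ∈ A} = M_k(ρ,c)(A)`. -/
theorem M_real_preimage_relabel_quarterTurn_symm {k : ℕ} (hk : k ≠ 0) (ρ c : ℝ) (u : Site 2)
    (g : Site 2 ≃ Site 2) (hg : ∀ x, g x = ![ctr k u 0 + ctr k u 1 - x 1, x 0 - ctr k u 0 + ctr k u 1])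
    (A : Set (BondConfig (Site 2))) :
    (M k ρ c).real (BondConfig.relabel (sym2Equiv g.symm) ⁻¹' A) = (M k ρ c).real A := by
  rw [measureReal_def, measureReal_def, ← MeasurableEquiv.map_apply,
    M_map_relabel_quarterTurn_symm hk ρ c u g hg]

/-! ### Equivariance of coin influences -/

/-- `σ ⁻¹' (insert i S) = insert (σ⁻¹ i) (σ ⁻¹' S)`. -/
theorem preimage_insert_coin (σ : Coin ≃ Coin) (i : Coin) (S : Set Coin) :
    σ ⁻¹' (insert i S) = insert (σ.symm i) (σ ⁻¹' S) := by
  ext x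
  simp only [Set.mem_preimage, Set.mem_insert_iff, Equiv.apply_eq_iff_eq_symm_apply]

/-- `σ ⁻¹' (S \ {i}) = σ ⁻¹' S \ {σ⁻¹ i}`. -/
theorem preimage_diff_singleton_coin (σ : Coin ≃ Coin) (i : Coin) (S : Set Coin) :
    σ ⁻¹' (S \ {i}) = σ ⁻¹' S \ {σ.symm i} := by
  ext x
  simp only [Set.mem_preimage, Set.mem_sdiff, Set.mem_singleton_iff, Equiv.apply_eq_iff_eq_symm_apply]

/-- **"Coin `i` forced on" transports to "coin `σ⁻¹ i` forced on"**: for a bias-preserving `σ` and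
every coin event `X`, `coinLaw {S | insert i S ∈ (σ ⁻¹' ·)⁻¹ X} = coinLaw {S | insert (σ⁻¹ i) S ∈ X}`. -/
theorem coinLaw_real_setOf_insert_mem_pullback (k : ℕ) (q : ℝ × ℝ) (σ : Coin ≃ Coin)
    (hprm : ∀ i, prm k q.1 q.2 (σ i) = prm k q.1 q.2 i) (X : Set (Set Coin)) (i : Coin) :
    (coinLaw k q).real {S | insert i S ∈ (fun S : Set Coin => σ ⁻¹' S) ⁻¹' X} =
      (coinLaw k q).real {S | insert (σ.symm i) S ∈ X} := by
  have h : {S : Set Coin | insert i S ∈ (fun S : Set Coin => σ ⁻¹' S) ⁻¹' X} =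
      (fun S : Set Coin => σ ⁻¹' S) ⁻¹' {S | insert (σ.symm i) S ∈ X} := by
    ext S
    simp only [Set.mem_setOf_eq, Set.mem_preimage, preimage_insert_coin]
  rw [h, coinLaw_real_preimage_pullback k q σ hprm]

/-- **"Coin `i` forced off" transports to "coin `σ⁻¹ i` forced off"**. -/
theorem coinLaw_real_setOf_diff_mem_pullback (k : ℕ) (q : ℝ × ℝ) (σ : Coin ≃ Coin)
    (hprm : ∀ i, prm k q.1 q.2 (σ i) = prm k q.1 q.2 i) (X : Set (Set Coin)) (i : Coin) :
    (coinLaw k q).real {S | S \ {i} ∈ (fun S : Set Coin => σ ⁻¹' S) ⁻¹' X} =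
      (coinLaw k q).real {S | S \ {σ.symm i} ∈ X} := by
  have h : {S : Set Coin | S \ {i} ∈ (fun S : Set Coin => σ ⁻¹' S) ⁻¹' X} =
      (fun S : Set Coin => σ ⁻¹' S) ⁻¹' {S | S \ {σ.symm i} ∈ X} := by
    ext S
    simp only [Set.mem_setOf_eq, Set.mem_preimage, preimage_diff_singleton_coin]
  rw [h, coinLaw_real_preimage_pullback k q σ hprm]

/-- For an intertwined pair, the coin event of the rotated event `{ω | g '' ω ∈ B}` is the pull-back
of the coin event of `B`: `cfg k ⁻¹' {ω | g '' ω ∈ B} = {S | σ ⁻¹' S ∈ cfg k ⁻¹' B}`. -/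
theorem preimage_cfg_preimage_relabel {k : ℕ} {g : Site 2 ≃ Site 2} {σ : Coin ≃ Coin}
    (hcfg : ∀ S, BondConfig.relabel (sym2Equiv g) (cfg k S) = cfg k (σ ⁻¹' S))
    (B : Set (BondConfig (Site 2))) :
    cfg k ⁻¹' (BondConfig.relabel (sym2Equiv g) ⁻¹' B) =
      (fun S : Set Coin => σ ⁻¹' S) ⁻¹' (cfg k ⁻¹' B) := by
  ext S
  show BondConfig.relabel (sym2Equiv g) (cfg k S) ∈ B ↔ cfg k (σ ⁻¹' S) ∈ B
  rw [hcfg]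

/-- **Equivariance of signed influences** (intertwined bias-preserving pair `(g, σ)`, ANY event
`B`): the signed influence `coinLaw {S | insert i S ∈ ·} − coinLaw {S | S \ {i} ∈ ·}` of the coin
`i` on the coin event of the rotated event `{ω | g '' ω ∈ B}` equals the signed influence of the
coin `σ⁻¹ i` on the coin event of `B`. -/
theorem infl_pullback_eq {k : ℕ} (q : ℝ × ℝ) {g : Site 2 ≃ Site 2} {σ : Coin ≃ Coin}
    (hcfg : ∀ S, BondConfig.relabel (sym2Equiv g) (cfg k S) = cfg k (σ ⁻¹' S))
    (hprm : ∀ i, prm k q.1 q.2 (σ i) = prm k q.1 q.2 i) (B : Set (BondConfig (Site 2))) (i : Coin) :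
    (coinLaw k q).real {S | insert i S ∈ cfg k ⁻¹' (BondConfig.relabel (sym2Equiv g) ⁻¹' B)} -
        (coinLaw k q).real {S | S \ {i} ∈ cfg k ⁻¹' (BondConfig.relabel (sym2Equiv g) ⁻¹' B)} =
      (coinLaw k q).real {S | insert (σ.symm i) S ∈ cfg k ⁻¹' B} -
        (coinLaw k q).real {S | S \ {σ.symm i} ∈ cfg k ⁻¹' B} := by
  rw [preimage_cfg_preimage_relabel hcfg, coinLaw_real_setOf_insert_mem_pullback k q σ hprm,
    coinLaw_real_setOf_diff_mem_pullback k q σ hprm]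

/-- **Equivariance of influences under the quarter turn about `k•u`** (`k ≠ 0`; `g` and `σ` given
by their formulas, ANY event `B` of bond configurations): the signed influence of the coin `i` on
the coin event of the rotated event `{ω | g '' ω ∈ B}` is the signed influence of the coin `σ⁻¹ i`
(own coin of the image edge / same coin of the image bundle) on the coin event of `B`. -/
theorem infl_quarterTurn {k : ℕ} (hk : k ≠ 0) (q : ℝ × ℝ) (u : Site 2) (g : Site 2 ≃ Site 2)
    (σ : Coin ≃ Coin) (hg : ∀ x, g x = ![ctr k u 0 + ctr k u 1 - x 1, x 0 - ctr k u 0 + ctr k u 1])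
    (h0 : ∀ (v : Site 2) (d : Fin 2), σ (v, d, 0) =
      (![v 1 - ctr k u 1 + ctr k u 0, ctr k u 0 + ctr k u 1 - v 0 - (if d = 0 then 1 else 0)],
        Equiv.swap 0 1 d, 0))
    (h : ∀ (t : Site 2) (d : Fin 2) (j : Fin 3), j ≠ 0 → σ (t, d, j) =
      (![t 1 - u 1 + u 0, u 0 + u 1 - t 0 - (if d = 0 then 1 else 0)], Equiv.swap 0 1 d, j))
    (B : Set (BondConfig (Site 2))) (i : Coin) :
    (coinLaw k q).real {S | insert i S ∈ cfg k ⁻¹' (BondConfig.relabel (sym2Equiv g) ⁻¹' B)} -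
        (coinLaw k q).real {S | S \ {i} ∈ cfg k ⁻¹' (BondConfig.relabel (sym2Equiv g) ⁻¹' B)} =
      (coinLaw k q).real {S | insert (σ.symm i) S ∈ cfg k ⁻¹' B} -
        (coinLaw k q).real {S | S \ {σ.symm i} ∈ cfg k ⁻¹' B} := by
  obtain ⟨g', σ', hg', h0', h', hcfg, hprm⟩ := exists_quarterTurn hk u
  obtain rfl : g = g' := quarterTurn_unique hg hg'
  obtain rfl : σ = σ' := quarterTurn_coin_unique h0 h h0' h'
  exact infl_pullback_eq q hcfg (hprm q.1 q.2) B i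

end Summit.CriticalPhenomena.CardyFormulaZ2.Theorems.CardySelfRefinement.FarField

end
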